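import Summits.Ventures.CertifiedManyBodySolver.Downfold.EmeryOrbitalWeightFaceBox
import Summits.Ventures.CertifiedManyBodySolver.Downfold.EmeryVanHoveSubBox
import Summits.Ventures.CertifiedManyBodySolver.Downfold.EmeryVanHoveTableA
import Summits.Ventures.CertifiedManyBodySolver.Downfold.EmeryVanHoveTableH
import Summits.Ventures.CertifiedManyBodySolver.Downfold.EmeryFermiFacePointsLa214SOLX007S1
import Summits.Ventures.CertifiedManyBodySolver.Downfold.EmeryFermiFacePointsLa214ALLX007S1
import Summits.Ventures.CertifiedManyBodySolver.Downfold.EmeryFermiFacePointsLa214SOLX007S2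
import Summits.Ventures.CertifiedManyBodySolver.Downfold.EmeryFermiFacePointsLa214ALLX007S2
import Summits.Ventures.CertifiedManyBodySolver.Downfold.EmeryFermiFacePointsLa214SOLX007S3
import Summits.Ventures.CertifiedManyBodySolver.Downfold.EmeryFermiFacePointsLa214ALLX007S3
import HarnessLib

/-!
# THE ANTINODAL FERMI-SURFACE Cu-d WEIGHT OVER THE TYPED 3BE BOX `emeryBoxLa214v123 ∩ {Δ_pd ∈ [3.24, 4.0]} (solver-level Δ tag)` AT FILLING x = 0.07 (ν = 93/200) — the kinematic leg of the UPPER member `U_B∣full(w_antinode)` of the weak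
# band-level `U` bracket read over a box (INFL-3to1-B §B.90; kernel `EmeryOrbitalWeightFaceBox`; router/OBJECT-E-BUDGET.tsv §C)

Venture CertifiedManyBodySolver, cell `pub/hubbard-downfold` (stage S1), seat hubbard-downfold-mod-4 (technique B, g38 device, g42 run — INFL-3to1-B §B.94–§B.97, the remaining LSCO validation columns); namespace
`Summit.Ventures.CertifiedManyBodySolver.Downfold.Emery`. Everything PROVED (0 sorry). WHAT THIS IS NOT: a statement about the material — the typed box (La₂₋ₓSrₓCuO₄ box #18 — SOLVER-LEVEL Δ_pd members [3.24, 4.0] (§OF-RECORD v1.2 level tag))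
is SCREENING-GRADE; `U = 0` one-body kinematics of the σ model; the `U_B` arithmetic that consumes the window is DERIVED context on the MEAN-FIELD annex (R-B17).

For every member θ = (Δ, t_pd, t_pp, t_pp′) ∈ [3.24, 4] × [1.29, 1.52] × [0.46, 0.66] × [0.12, 0.15] eV at filling ν = 93/200, the Cu-d weight of the ANTINODAL Bloch state (the zone-face
point of the member's own Fermi surface — the MOST Cu-like Fermi point, `EmeryOrbitalWeightMonotone`), `dWeightFace θ (fermiEnergyOf θ ν)`, lies in the window below.
DEVICE: `W(θ) = W(Δ/t_pd, 1, t_pp/t_pd, t_pp′/t_pd)` (scaling law); the t_pd range is cut into 3 slabs; on each normalised slab the THREE-COORDINATE CORNER RULE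
`dWeightFace_fermiEnergyOf_mem_Icc_of_mem_box3_num` (levers Δ ↑, t_pp ↓, t_pp′ ↑ at fixed filling; hole-likeness from the slab's `vhBoxCheck` + the Ψ table; the upper
face edge from four corner inequalities; the antinodal charge-transfer regime `4(t_pp + t_pp′) ≤ Δ + ε_F` at two corners) is read on three K = 384 Fermi-energy brackets
(`EmeryFermiFacePointsLa214SOLX007S<k>`). The slab corners `(Δ₂/a₁, 1, b₁/a₂, c₂/a₁)` are VIRTUAL (not members): the window is a sound ENCLOSURE, a few 10⁻³ wider than the image.

| t_pd slab (eV) | normalised slab Δ/t_pd × t_pp/t_pd × t_pp′/t_pd | q₁ (vhBoxCheck) ≥ table point | E_h | E_R | E_v | regime margins (R1, R2) | **w_face window** |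
|---|---|---|---|---|---|---|---|
| [1.29, 1.37] | [2.365, 3.101] × [0.3358, 0.5116] × [0.08759, 0.1163] | 0.2552 ≥ 1/4 (Ψ ≤ 0.4328) | 1.1517 | 1.0795 | 0.927 | +0.933, +2.220 | **[0.7561, 0.8258]** |
| [1.37, 1.45] | [2.234, 2.92] × [0.3172, 0.4818] × [0.08276, 0.1095] | 0.2493 ≥ 6/25 (Ψ ≤ 0.4349) | 1.1818 | 1.1117 | 0.9616 | +0.981, +2.174 | **[0.7464, 0.8148]** |
| [1.45, 1.52] | [2.132, 2.759] × [0.3026, 0.4552] × [0.07895, 0.1034] | 0.2453 ≥ 6/25 (Ψ ≤ 0.4349) | 1.2063 | 1.139 | 0.9961 | +1.036, +2.130 | **[0.7385, 0.804]** |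
| **whole box** | (hull of the slabs) | | | | | | **[0.7385, 0.8258]** |

Sources: three-band model [HybertsenSchluterChristensen1989, Eq. (1)]; face point of the bilinear contour [AndersenEtAl1995, §6]; [folklore] algebra.
-/

noncomputable section

namespace Summit.Ventures.CertifiedManyBodySolver.Downfold.Emery

open Real Set

/-- **Slab 1 (t_pd ∈ [1.29, 1.37] eV) of `emeryBoxLa214v123 ∩ {Δ_pd ∈ [3.24, 4.0]} (solver-level Δ tag)`, ν = 93/200: the antinodal Fermi-surface Cu-d weight of every member lies in `[0.7561, 0.8258]`**
(normalised-slab corner rule; brackets `facePt_La214SOL_x007_s1_lo_br` / `_R_br` / `_hi_br`). [folklore] -/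
theorem la214SOLBox_dWeightFace_x007_s1 {Δ a b c : ℝ} (hΔ : Δ ∈ Icc ((81 : ℝ) / 25) (4 : ℝ)) (ha : a ∈ Icc ((129 : ℝ) / 100) ((137 : ℝ) / 100)) (hb : b ∈ Icc ((23 : ℝ) / 50) ((33 : ℝ) / 50)) (hc : c ∈ Icc ((3 : ℝ) / 25) ((3 : ℝ) / 20)) :
    dWeightFace Δ a b c (fermiEnergyOf Δ a b c ((93 : ℝ) / 200)) ∈ Icc ((7561 : ℝ) / 10000) ((4129 : ℝ) / 5000) := by
  have ha0 : 0 < a := lt_of_lt_of_le (by norm_num) ha.1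
  rw [dWeightFace_fermiEnergyOf_eq_ratios ha0]
  have hΔn : Δ / a ∈ Icc ((324 : ℝ) / 137) ((400 : ℝ) / 129) := by
    constructor
    · rw [le_div_iff₀ ha0]; linarith [hΔ.1, ha.2]
    · rw [div_le_iff₀ ha0]; linarith [hΔ.2, ha.1]
  have hbn : b / a ∈ Icc ((46 : ℝ) / 137) ((22 : ℝ) / 43) := by
    constructor
    · rw [le_div_iff₀ ha0]; linarith [hb.1, ha.2]
    · rw [div_le_iff₀ ha0]; linarith [hb.2, ha.1]
  have hcn : c / a ∈ Icc ((12 : ℝ) / 137) ((5 : ℝ) / 43) := by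
    constructor
    · rw [le_div_iff₀ ha0]; linarith [hc.1, ha.2]
    · rw [div_le_iff₀ ha0]; linarith [hc.2, ha.1]
  have hVH : ∀ Δ' b' c' : ℝ, Δ' ∈ Icc ((324 : ℝ) / 137) ((400 : ℝ) / 129) → b' ∈ Icc ((46 : ℝ) / 137) ((22 : ℝ) / 43) → c' ∈ Icc ((12 : ℝ) / 137) ((5 : ℝ) / 43) →
      1 - 2 * ((93 : ℝ) / 200) ≤ xVH Δ' 1 b' c' := by
    intro Δ' b' c' hΔ' hb' hc'
    have h := xVH_window_of_vhBoxCheck (Δ₁ := ((324 : ℚ) / 137)) (Δ₂ := ((400 : ℚ) / 129)) (a₁ := (1 : ℚ)) (a₂ := (1 : ℚ)) (b₁ := ((46 : ℚ) / 137)) (b₂ := ((22 : ℚ) / 43))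
      (c₁ := ((12 : ℚ) / 137)) (c₂ := ((5 : ℚ) / 43)) (v₁ := ((2241 : ℚ) / 2500)) (v₂ := ((10597 : ℚ) / 10000)) (e := ((10349 : ℚ) / 10000)) (E := ((229 : ℚ) / 250))
      (q₁ := ((319 : ℚ) / 1250)) (q₂ := ((5059 : ℚ) / 10000)) (by decide +kernel)
      (Δ := Δ') (tpd := 1) (tpp := b') (c := c') (by simpa using hΔ') (by simp) (by simpa using hb') (by simpa using hc')
    obtain ⟨-, -, -, -, -, hwin⟩ := h
    push_cast at hwin
    have ht := vhFrac_1_4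
    have hmono := vhFrac_anti (show (1 / 4 : ℝ) ≤ ((319 : ℝ) / 1250) by norm_num)
    have hnu : ((63817 : ℝ) / 147456) ≤ ((93 : ℝ) / 200) := by norm_num
    linarith [hwin.1, ht.2]
  have hEh := (fermiEnergyOf_of_pointBracketCheck facePt_La214SOL_x007_s1_lo_br (by norm_num) (by norm_num) (by norm_num) (ν := (93/200 : ℝ))
    (by push_cast; exact ⟨le_rfl, le_rfl⟩)).2
  have hER := (fermiEnergyOf_of_pointBracketCheck facePt_La214SOL_x007_s1_R_br (by norm_num) (by norm_num) (by norm_num) (ν := (93/200 : ℝ))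
    (by push_cast; exact ⟨le_rfl, le_rfl⟩)).2
  have hEv := (fermiEnergyOf_of_pointBracketCheck facePt_La214ALL_x007_s1_hi_br (by norm_num) (by norm_num) (by norm_num) (ν := (93/200 : ℝ))
    (by push_cast; exact ⟨le_rfl, le_rfl⟩)).2
  push_cast at hEh hER hEv
  exact dWeightFace_fermiEnergyOf_mem_Icc_of_mem_box3_num (Eh := ((11517 : ℝ) / 10000)) (ER := ((2159 : ℝ) / 2000)) (Ev := ((927 : ℝ) / 1000))
    (by norm_num) one_pos (by norm_num) (by norm_num) hΔn hbn hcn (by norm_num) (by norm_num) hVH hEh.2 (by norm_num)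
    (by norm_num [faceU, fsD, fsN, cA]) (by norm_num [faceU, fsD, fsN, cA]) (by norm_num [faceU, fsD, fsN, cA]) (by norm_num [faceU, fsD, fsN, cA])
    hER.1 (by norm_num) hEv.1 (by norm_num) (by norm_num) (by norm_num [faceG])
    (by norm_num [dWeightFaceCF, faceN, faceR, fsN]) (by norm_num [dWeightFaceCF, faceN, faceR, fsN])

/-- **Slab 2 (t_pd ∈ [1.37, 1.45] eV) of `emeryBoxLa214v123 ∩ {Δ_pd ∈ [3.24, 4.0]} (solver-level Δ tag)`, ν = 93/200: the antinodal Fermi-surface Cu-d weight of every member lies in `[0.7464, 0.8148]`**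
(normalised-slab corner rule; brackets `facePt_La214SOL_x007_s2_lo_br` / `_R_br` / `_hi_br`). [folklore] -/
theorem la214SOLBox_dWeightFace_x007_s2 {Δ a b c : ℝ} (hΔ : Δ ∈ Icc ((81 : ℝ) / 25) (4 : ℝ)) (ha : a ∈ Icc ((137 : ℝ) / 100) ((29 : ℝ) / 20)) (hb : b ∈ Icc ((23 : ℝ) / 50) ((33 : ℝ) / 50)) (hc : c ∈ Icc ((3 : ℝ) / 25) ((3 : ℝ) / 20)) :
    dWeightFace Δ a b c (fermiEnergyOf Δ a b c ((93 : ℝ) / 200)) ∈ Icc ((933 : ℝ) / 1250) ((2037 : ℝ) / 2500) := by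
  have ha0 : 0 < a := lt_of_lt_of_le (by norm_num) ha.1
  rw [dWeightFace_fermiEnergyOf_eq_ratios ha0]
  have hΔn : Δ / a ∈ Icc ((324 : ℝ) / 145) ((400 : ℝ) / 137) := by
    constructor
    · rw [le_div_iff₀ ha0]; linarith [hΔ.1, ha.2]
    · rw [div_le_iff₀ ha0]; linarith [hΔ.2, ha.1]
  have hbn : b / a ∈ Icc ((46 : ℝ) / 145) ((66 : ℝ) / 137) := by
    constructor
    · rw [le_div_iff₀ ha0]; linarith [hb.1, ha.2]
    · rw [div_le_iff₀ ha0]; linarith [hb.2, ha.1]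
  have hcn : c / a ∈ Icc ((12 : ℝ) / 145) ((15 : ℝ) / 137) := by
    constructor
    · rw [le_div_iff₀ ha0]; linarith [hc.1, ha.2]
    · rw [div_le_iff₀ ha0]; linarith [hc.2, ha.1]
  have hVH : ∀ Δ' b' c' : ℝ, Δ' ∈ Icc ((324 : ℝ) / 145) ((400 : ℝ) / 137) → b' ∈ Icc ((46 : ℝ) / 145) ((66 : ℝ) / 137) → c' ∈ Icc ((12 : ℝ) / 145) ((15 : ℝ) / 137) →
      1 - 2 * ((93 : ℝ) / 200) ≤ xVH Δ' 1 b' c' := by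
    intro Δ' b' c' hΔ' hb' hc'
    have h := xVH_window_of_vhBoxCheck (Δ₁ := ((324 : ℚ) / 145)) (Δ₂ := ((400 : ℚ) / 137)) (a₁ := (1 : ℚ)) (a₂ := (1 : ℚ)) (b₁ := ((46 : ℚ) / 145)) (b₂ := ((66 : ℚ) / 137))
      (c₁ := ((12 : ℚ) / 145)) (c₂ := ((15 : ℚ) / 137)) (v₁ := ((9323 : ℚ) / 10000)) (v₂ := ((10933 : ℚ) / 10000)) (e := ((1069 : ℚ) / 1000)) (E := ((9519 : ℚ) / 10000))
      (q₁ := ((2493 : ℚ) / 10000)) (q₂ := ((4861 : ℚ) / 10000)) (by decide +kernel)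
      (Δ := Δ') (tpd := 1) (tpp := b') (c := c') (by simpa using hΔ') (by simp) (by simpa using hb') (by simpa using hc')
    obtain ⟨-, -, -, -, -, hwin⟩ := h
    push_cast at hwin
    have ht := vhFrac_6_25
    have hmono := vhFrac_anti (show (6 / 25 : ℝ) ≤ ((2493 : ℝ) / 10000) by norm_num)
    have hnu : ((64128 : ℝ) / 147456) ≤ ((93 : ℝ) / 200) := by norm_num
    linarith [hwin.1, ht.2]
  have hEh := (fermiEnergyOf_of_pointBracketCheck facePt_La214SOL_x007_s2_lo_br (by norm_num) (by norm_num) (by norm_num) (ν := (93/200 : ℝ))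
    (by push_cast; exact ⟨le_rfl, le_rfl⟩)).2
  have hER := (fermiEnergyOf_of_pointBracketCheck facePt_La214SOL_x007_s2_R_br (by norm_num) (by norm_num) (by norm_num) (ν := (93/200 : ℝ))
    (by push_cast; exact ⟨le_rfl, le_rfl⟩)).2
  have hEv := (fermiEnergyOf_of_pointBracketCheck facePt_La214ALL_x007_s2_hi_br (by norm_num) (by norm_num) (by norm_num) (ν := (93/200 : ℝ))
    (by push_cast; exact ⟨le_rfl, le_rfl⟩)).2
  push_cast at hEh hER hEv
  exact dWeightFace_fermiEnergyOf_mem_Icc_of_mem_box3_num (Eh := ((5909 : ℝ) / 5000)) (ER := ((11117 : ℝ) / 10000)) (Ev := ((601 : ℝ) / 625))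
    (by norm_num) one_pos (by norm_num) (by norm_num) hΔn hbn hcn (by norm_num) (by norm_num) hVH hEh.2 (by norm_num)
    (by norm_num [faceU, fsD, fsN, cA]) (by norm_num [faceU, fsD, fsN, cA]) (by norm_num [faceU, fsD, fsN, cA]) (by norm_num [faceU, fsD, fsN, cA])
    hER.1 (by norm_num) hEv.1 (by norm_num) (by norm_num) (by norm_num [faceG])
    (by norm_num [dWeightFaceCF, faceN, faceR, fsN]) (by norm_num [dWeightFaceCF, faceN, faceR, fsN])

/-- **Slab 3 (t_pd ∈ [1.45, 1.52] eV) of `emeryBoxLa214v123 ∩ {Δ_pd ∈ [3.24, 4.0]} (solver-level Δ tag)`, ν = 93/200: the antinodal Fermi-surface Cu-d weight of every member lies in `[0.7385, 0.804]`**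
(normalised-slab corner rule; brackets `facePt_La214SOL_x007_s3_lo_br` / `_R_br` / `_hi_br`). [folklore] -/
theorem la214SOLBox_dWeightFace_x007_s3 {Δ a b c : ℝ} (hΔ : Δ ∈ Icc ((81 : ℝ) / 25) (4 : ℝ)) (ha : a ∈ Icc ((29 : ℝ) / 20) ((38 : ℝ) / 25)) (hb : b ∈ Icc ((23 : ℝ) / 50) ((33 : ℝ) / 50)) (hc : c ∈ Icc ((3 : ℝ) / 25) ((3 : ℝ) / 20)) :
    dWeightFace Δ a b c (fermiEnergyOf Δ a b c ((93 : ℝ) / 200)) ∈ Icc ((1477 : ℝ) / 2000) ((201 : ℝ) / 250) := by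
  have ha0 : 0 < a := lt_of_lt_of_le (by norm_num) ha.1
  rw [dWeightFace_fermiEnergyOf_eq_ratios ha0]
  have hΔn : Δ / a ∈ Icc ((81 : ℝ) / 38) ((80 : ℝ) / 29) := by
    constructor
    · rw [le_div_iff₀ ha0]; linarith [hΔ.1, ha.2]
    · rw [div_le_iff₀ ha0]; linarith [hΔ.2, ha.1]
  have hbn : b / a ∈ Icc ((23 : ℝ) / 76) ((66 : ℝ) / 145) := by
    constructor
    · rw [le_div_iff₀ ha0]; linarith [hb.1, ha.2]
    · rw [div_le_iff₀ ha0]; linarith [hb.2, ha.1]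
  have hcn : c / a ∈ Icc ((3 : ℝ) / 38) ((3 : ℝ) / 29) := by
    constructor
    · rw [le_div_iff₀ ha0]; linarith [hc.1, ha.2]
    · rw [div_le_iff₀ ha0]; linarith [hc.2, ha.1]
  have hVH : ∀ Δ' b' c' : ℝ, Δ' ∈ Icc ((81 : ℝ) / 38) ((80 : ℝ) / 29) → b' ∈ Icc ((23 : ℝ) / 76) ((66 : ℝ) / 145) → c' ∈ Icc ((3 : ℝ) / 38) ((3 : ℝ) / 29) →
      1 - 2 * ((93 : ℝ) / 200) ≤ xVH Δ' 1 b' c' := by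
    intro Δ' b' c' hΔ' hb' hc'
    have h := xVH_window_of_vhBoxCheck (Δ₁ := ((81 : ℚ) / 38)) (Δ₂ := ((80 : ℚ) / 29)) (a₁ := (1 : ℚ)) (a₂ := (1 : ℚ)) (b₁ := ((23 : ℚ) / 76)) (b₂ := ((66 : ℚ) / 145))
      (c₁ := ((3 : ℚ) / 38)) (c₂ := ((3 : ℚ) / 29)) (v₁ := ((604 : ℚ) / 625)) (v₂ := ((1121 : ℚ) / 1000)) (e := ((10979 : ℚ) / 10000)) (E := ((9853 : ℚ) / 10000))
      (q₁ := ((2453 : ℚ) / 10000)) (q₂ := ((4657 : ℚ) / 10000)) (by decide +kernel)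
      (Δ := Δ') (tpd := 1) (tpp := b') (c := c') (by simpa using hΔ') (by simp) (by simpa using hb') (by simpa using hc')
    obtain ⟨-, -, -, -, -, hwin⟩ := h
    push_cast at hwin
    have ht := vhFrac_6_25
    have hmono := vhFrac_anti (show (6 / 25 : ℝ) ≤ ((2453 : ℝ) / 10000) by norm_num)
    have hnu : ((64128 : ℝ) / 147456) ≤ ((93 : ℝ) / 200) := by norm_num
    linarith [hwin.1, ht.2]
  have hEh := (fermiEnergyOf_of_pointBracketCheck facePt_La214SOL_x007_s3_lo_br (by norm_num) (by norm_num) (by norm_num) (ν := (93/200 : ℝ))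
    (by push_cast; exact ⟨le_rfl, le_rfl⟩)).2
  have hER := (fermiEnergyOf_of_pointBracketCheck facePt_La214SOL_x007_s3_R_br (by norm_num) (by norm_num) (by norm_num) (ν := (93/200 : ℝ))
    (by push_cast; exact ⟨le_rfl, le_rfl⟩)).2
  have hEv := (fermiEnergyOf_of_pointBracketCheck facePt_La214ALL_x007_s3_hi_br (by norm_num) (by norm_num) (by norm_num) (ν := (93/200 : ℝ))
    (by push_cast; exact ⟨le_rfl, le_rfl⟩)).2
  push_cast at hEh hER hEv
  exact dWeightFace_fermiEnergyOf_mem_Icc_of_mem_box3_num (Eh := ((12063 : ℝ) / 10000)) (ER := ((1139 : ℝ) / 1000)) (Ev := ((9961 : ℝ) / 10000))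
    (by norm_num) one_pos (by norm_num) (by norm_num) hΔn hbn hcn (by norm_num) (by norm_num) hVH hEh.2 (by norm_num)
    (by norm_num [faceU, fsD, fsN, cA]) (by norm_num [faceU, fsD, fsN, cA]) (by norm_num [faceU, fsD, fsN, cA]) (by norm_num [faceU, fsD, fsN, cA])
    hER.1 (by norm_num) hEv.1 (by norm_num) (by norm_num) (by norm_num [faceG])
    (by norm_num [dWeightFaceCF, faceN, faceR, fsN]) (by norm_num [dWeightFaceCF, faceN, faceR, fsN])

/-- **`emeryBoxLa214v123 ∩ {Δ_pd ∈ [3.24, 4.0]} (solver-level Δ tag)`, ν = 93/200: for EVERY member θ the Cu-d weight of the antinodal Fermi-surface state lies in `[0.7385, 0.8258]`** (hull of the 3 t_pd slab windows). [folklore] -/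
theorem la214SOLBox_dWeightFace_x007 {Δ a b c : ℝ} (hΔ : Δ ∈ Icc ((81 : ℝ) / 25) (4 : ℝ)) (ha : a ∈ Icc ((129 : ℝ) / 100) ((38 : ℝ) / 25)) (hb : b ∈ Icc ((23 : ℝ) / 50) ((33 : ℝ) / 50)) (hc : c ∈ Icc ((3 : ℝ) / 25) ((3 : ℝ) / 20)) :
    dWeightFace Δ a b c (fermiEnergyOf Δ a b c ((93 : ℝ) / 200)) ∈ Icc ((1477 : ℝ) / 2000) ((4129 : ℝ) / 5000) := by
  rcases le_or_gt a ((137 : ℝ) / 100) with h1 | h1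
  · have h := la214SOLBox_dWeightFace_x007_s1 hΔ ⟨ha.1, h1⟩ hb hc
    exact ⟨le_trans (by norm_num) h.1, le_trans h.2 (by norm_num)⟩
  · rcases le_or_gt a ((29 : ℝ) / 20) with h2 | h2
    · have h := la214SOLBox_dWeightFace_x007_s2 hΔ ⟨h1.le, h2⟩ hb hc
      exact ⟨le_trans (by norm_num) h.1, le_trans h.2 (by norm_num)⟩
    · have h := la214SOLBox_dWeightFace_x007_s3 hΔ ⟨h2.le, ha.2⟩ hb hc
      exact ⟨le_trans (by norm_num) h.1, le_trans h.2 (by norm_num)⟩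

end Summit.Ventures.CertifiedManyBodySolver.Downfold.Emery
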